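import Summits.ResolutionOfSingularities.ResolutionOfSingularities.Theorems.FrobeniusClosingCampaignW41Core4KuhlmannSeries
import Mathlib.RingTheory.Algebraic.Basic
import Mathlib.FieldTheory.IntermediateField.Adjoin.Algebra
import Mathlib.FieldTheory.IntermediateField.Adjoin.Basic
import Mathlib.LinearAlgebra.Dimension.Finite
import Mathlib.SetTheory.Cardinal.Subfield
import Mathlib.Algebra.Polynomial.Cardinal
import Mathlib.Algebra.Polynomial.Inductions
import HarnessLib

/-!
# Crux `Steer` (stmt-16345), chain W4.1 / kill test K4.1b: transcendence tools inside a Hahn-series field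

OURS (campaign `res-hironaka`, rung L, slot W4.1; replaces the role of no printed item; NOT a statement of
the manuscript under review). Third brick of the KERNEL inhabitant of the dim-`≥ 4` Steer core (K4.1b
«ALIVE-BY-KERNEL», seat res-L0-k41): the two elementary devices that replace a transcendence proof for the
generators of the datum.

* `exists_ne_orderTop_eq_of_sum_eq_zero`: in a valued field, a vanishing finite sum with a non-zero term has
  two distinct non-zero terms of EQUAL value (ultrametric principle).
* `exists_nsmul_order_of_isAlgebraic` («fundamental-inequality torsion»): if `a` is algebraic over a subfield
  `E` of the Hahn-series field, of degree `d`, then every non-zero `z ∈ E(a)` has `n • order z ∈ vE − vE`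
  for some `1 ≤ n ≤ d` — so an element whose value has a denominator beyond every `n ≤ d` relative to the
  values of `E` forces `a` to be TRANSCENDENTAL over `E`.
* `order_aeval_eq_nsmul`, `order_eq_zsmul_of_mem_adjoin_simple`: the values of `k(u)` for a series `u` of
  positive order are the integer multiples of `order u` (so `u` is transcendental over `k`).
* `pow_mem_adjoin_image_pow`: Frobenius maps `k[S]` into `k[S^p]`.
* `exists_natSer_transcendental`: over a COUNTABLE subalgebra of `Ω = 𝔽_p⟦x^{ℤ[1/p]}⟧` some power series
  `Σ c_n x^{n+1}` is transcendental (algebraic elements over a countable ring are countable, coefficient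
  sequences are not) — a counting argument replacing a lacunary-series estimate.

No `Theses.*` / `Cruxes.*` import (chain build rule). All statements are folklore.
-/

-- layout-mandated namespace `Summit.<Summit>.<Problem>.…` with Summit = Problem (single-conjunct summit)
set_option linter.dupNamespace false

namespace Summit.ResolutionOfSingularities.ResolutionOfSingularities.Theorems.SwitchingDichotomy.Core4Hahn


universe u v

section General

variable {Γ : Type u} [AddCommGroup Γ] [LinearOrder Γ] [IsOrderedAddMonoid Γ] {k : Type v} [Field k]

/-! ## Ultrametric principle: a vanishing sum has two terms of equal value -/

/-- **Two terms of equal value.** If a finite sum of Hahn series vanishes and one term is non-zero, then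
two DISTINCT non-zero terms have the same `orderTop`. [folklore] -/
theorem exists_ne_orderTop_eq_of_sum_eq_zero {ι : Type*} (s : Finset ι) (f : ι → HahnSeries Γ k)
    (hsum : ∑ i ∈ s, f i = 0) {i₀ : ι} (hi₀ : i₀ ∈ s) (h0 : f i₀ ≠ 0) :
    ∃ i ∈ s, ∃ j ∈ s, i ≠ j ∧ f i ≠ 0 ∧ f j ≠ 0 ∧ (f i).orderTop = (f j).orderTop := by
  classical
  by_contra! hcon
  set v := hahnVal Γ k with hv
  -- the non-zero terms
  set s' := s.filter fun i => f i ≠ 0 with hs'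
  have hne : s'.Nonempty := ⟨i₀, by rw [hs', Finset.mem_filter]; exact ⟨hi₀, h0⟩⟩
  -- a term of maximal (multiplicative) value, i.e. minimal order
  obtain ⟨i₁, hi₁, hmax⟩ := Finset.exists_max_image s' (fun i => v (f i)) hne
  rw [hs', Finset.mem_filter] at hi₁
  have hlt : ∀ j ∈ s.erase i₁, v (f j) < v (f i₁) := by
    intro j hj
    rw [Finset.mem_erase] at hj
    by_cases hj0 : f j = 0
    · rw [hj0, map_zero]
      exact zero_lt_iff.mpr ((Valuation.ne_zero_iff _).mpr hi₁.2)
    · have hle : v (f j) ≤ v (f i₁) := hmax j (by rw [hs', Finset.mem_filter]; exact ⟨hj.2, hj0⟩)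
      refine lt_of_le_of_ne hle fun heq => ?_
      exact hcon j hj.2 i₁ hi₁.1 hj.1 hj0 hi₁.2 ((hahnVal_eq_iff).mp heq)
  have hrest : v (∑ j ∈ s.erase i₁, f j) < v (f i₁) :=
    Valuation.map_sum_lt _ ((Valuation.ne_zero_iff _).mpr hi₁.2) hlt
  have htot : v (∑ j ∈ s, f j) = v (f i₁) := by
    rw [← Finset.add_sum_erase s f hi₁.1, Valuation.map_add_eq_of_lt_left _ hrest]
  rw [hsum, map_zero] at htot
  exact (Valuation.ne_zero_iff _).mpr hi₁.2 htot.symm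

/-- The same with `order` for the two non-zero terms. [folklore] -/
theorem exists_ne_order_eq_of_sum_eq_zero {ι : Type*} (s : Finset ι) (f : ι → HahnSeries Γ k)
    (hsum : ∑ i ∈ s, f i = 0) {i₀ : ι} (hi₀ : i₀ ∈ s) (h0 : f i₀ ≠ 0) :
    ∃ i ∈ s, ∃ j ∈ s, i ≠ j ∧ f i ≠ 0 ∧ f j ≠ 0 ∧ (f i).order = (f j).order := by
  obtain ⟨i, hi, j, hj, hij, hi0, hj0, h⟩ := exists_ne_orderTop_eq_of_sum_eq_zero s f hsum hi₀ h0
  refine ⟨i, hi, j, hj, hij, hi0, hj0, ?_⟩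
  rw [← HahnSeries.order_eq_orderTop_of_ne_zero hi0, ← HahnSeries.order_eq_orderTop_of_ne_zero hj0] at h
  exact WithTop.coe_injective h

/-! ## Fundamental-inequality torsion: values in a finite extension -/

/-- **Torsion of values in an algebraic simple extension.** Let `E` be a subfield (intermediate field over
`k`) of the Hahn-series field and `a` algebraic over `E`. There is `d ≥ 1` (the degree `[E(a) : E]`) such
that every non-zero `z ∈ E(a)` satisfies `n • order z + order c = order b` for some `1 ≤ n ≤ d` and some
non-zero `b, c ∈ E`: the class of `order z` modulo the values of `E` is killed by some `n ≤ d`. (Proof: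
`1, z, …, z^d` are `E`-linearly dependent; in a vanishing `E`-combination two terms have equal value.)
[folklore] -/
theorem exists_nsmul_order_of_isAlgebraic (E : IntermediateField k (HahnSeries Γ k)) {a : HahnSeries Γ k}
    (ha : IsAlgebraic E a) :
    ∃ d : ℕ, 0 < d ∧ ∀ z : HahnSeries Γ k, z ∈ IntermediateField.adjoin E {a} → z ≠ 0 →
      ∃ n : ℕ, 0 < n ∧ n ≤ d ∧ ∃ b c : HahnSeries Γ k, b ∈ E ∧ c ∈ E ∧ b ≠ 0 ∧ c ≠ 0 ∧
        n • z.order + c.order = b.order := by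
  classical
  set L := IntermediateField.adjoin E {a} with hL
  haveI : FiniteDimensional E L := IntermediateField.adjoin.finiteDimensional ha.isIntegral
  set d := Module.finrank E L with hd
  have hdpos : 0 < d := Module.finrank_pos
  refine ⟨d, hdpos, fun z hz hz0 => ?_⟩
  set z' : L := ⟨z, hz⟩ with hz'
  -- `1, z, …, z^d` are linearly dependent over `E`
  set w : Fin (d + 1) → L := fun i => z' ^ (i : ℕ) with hw
  have hdep : ¬ LinearIndependent E w := by
    intro hli
    have := hli.fintype_card_le_finrank
    rw [Fintype.card_fin] at this
    omega
  obtain ⟨g, hg, i₀, hi₀⟩ := Fintype.not_linearIndependent_iff.mp hdep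
  -- the relation, read in the Hahn-series field
  have hrel : ∑ i : Fin (d + 1), ((g i : HahnSeries Γ k) * z ^ (i : ℕ)) = 0 := by
    have h1 := congrArg (fun y : L => (y : HahnSeries Γ k)) hg
    simp only [IntermediateField.coe_sum, ZeroMemClass.coe_zero] at h1
    rw [← h1]
    refine Finset.sum_congr rfl fun i _ => ?_
    rw [IntermediateField.coe_smul, IntermediateField.smul_def, smul_eq_mul, hw]
    simp only [IntermediateField.coe_pow, hz']
  have hterm0 : (g i₀ : HahnSeries Γ k) * z ^ (i₀ : ℕ) ≠ 0 :=
    mul_ne_zero (fun h => hi₀ (by exact_mod_cast h)) (pow_ne_zero _ hz0)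
  obtain ⟨i, -, j, -, hij, hi, hj, hval⟩ := exists_ne_order_eq_of_sum_eq_zero Finset.univ
    (fun i : Fin (d + 1) => (g i : HahnSeries Γ k) * z ^ (i : ℕ)) hrel (Finset.mem_univ i₀) hterm0
  have hgi : (g i : HahnSeries Γ k) ≠ 0 := fun h => hi (by rw [h, zero_mul])
  have hgj : (g j : HahnSeries Γ k) ≠ 0 := fun h => hj (by rw [h, zero_mul])
  rw [HahnSeries.order_mul hgi (pow_ne_zero _ hz0), HahnSeries.order_mul hgj (pow_ne_zero _ hz0),
    HahnSeries.order_pow, HahnSeries.order_pow] at hval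
  -- order g_i + i • oz = order g_j + j • oz, with i ≠ j
  rcases lt_or_gt_of_ne (Fin.val_injective.ne hij) with hlt | hlt
  · -- i < j: (j - i) • oz + order g_j = order g_i
    refine ⟨(j : ℕ) - i, Nat.sub_pos_of_lt hlt, ?_, (g i : HahnSeries Γ k), (g j : HahnSeries Γ k),
      (g i).2, (g j).2, hgi, hgj, ?_⟩
    · have := j.is_lt; omega
    · have hsplit : (j : ℕ) • z.order = ((j : ℕ) - i) • z.order + (i : ℕ) • z.order := by
        rw [← add_nsmul, Nat.sub_add_cancel hlt.le]
      rw [hsplit] at hval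
      -- hval : og_i + i•oz = og_j + ((j-i)•oz + i•oz)
      have := hval
      rw [← add_assoc] at this
      have h2 := add_right_cancel this
      rw [h2, add_comm]
  · refine ⟨(i : ℕ) - j, Nat.sub_pos_of_lt hlt, ?_, (g j : HahnSeries Γ k), (g i : HahnSeries Γ k),
      (g j).2, (g i).2, hgj, hgi, ?_⟩
    · have := i.is_lt; omega
    · have hsplit : (i : ℕ) • z.order = ((i : ℕ) - j) • z.order + (j : ℕ) • z.order := by
        rw [← add_nsmul, Nat.sub_add_cancel hlt.le]
      rw [hsplit] at hval
      have := hval.symm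
      rw [← add_assoc] at this
      have h2 := add_right_cancel this
      rw [h2, add_comm]

/-! ## Values of `k(u)` for a series `u` of positive order -/

/-- For `u` of positive order and a non-zero constant `c`, `C c + u * w` has order `0` for `w ∈ 𝒪`-like
`w` (here: any `w` with `0 ≤ orderTop (u * w)` suffices; we use `w = aeval u Q`). Auxiliary. [folklore] -/
theorem orderTop_C_add_eq_zero {c : k} (hc : c ≠ 0) {h : HahnSeries Γ k} (hh : 0 < h.orderTop) :
    (HahnSeries.C c + h).orderTop = 0 := by
  have hC : (HahnSeries.C c : HahnSeries Γ k).orderTop = 0 := by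
    rw [HahnSeries.C_apply, HahnSeries.orderTop_single hc, WithTop.coe_zero]
  rw [HahnSeries.orderTop_add_eq_left (by rw [hC]; exact hh), hC]

/-- Polynomial values at a series of non-negative order have non-negative order. [folklore] -/
theorem orderTop_aeval_nonneg {u : HahnSeries Γ k} (hu : 0 ≤ u.orderTop) (P : Polynomial k) :
    0 ≤ (Polynomial.aeval u P).orderTop := by
  have hmem : u ∈ 𝒪 Γ k := mem_𝒪_iff.mpr hu
  have : Polynomial.aeval u P ∈ 𝒪 Γ k := by
    rw [Polynomial.aeval_eq_sum_range]
    refine sum_mem fun i _ => ?_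
    rw [Algebra.smul_def]
    refine mul_mem ?_ (pow_mem hmem _)
    rw [mem_𝒪_iff, ← HahnSeries.C_eq_algebraMap]
    by_cases hc : P.coeff i = 0
    · rw [hc, map_zero, HahnSeries.orderTop_zero]; exact le_top
    · rw [HahnSeries.C_apply, HahnSeries.orderTop_single hc, WithTop.coe_zero]
  exact mem_𝒪_iff.mp this

/-- **Values of polynomials in `u`.** For `u ≠ 0` of positive order and `P ≠ 0`: `aeval u P ≠ 0` and
`order (aeval u P) = m • order u` for some `m : ℕ` (the order of vanishing of `P` at `0`). In particular `u`
is transcendental over `k`. [folklore] -/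
theorem order_aeval_eq_nsmul {u : HahnSeries Γ k} (hu0 : u ≠ 0) (hu : 0 < u.orderTop) :
    ∀ P : Polynomial k, P ≠ 0 →
      Polynomial.aeval u P ≠ 0 ∧ ∃ m : ℕ, (Polynomial.aeval u P).order = m • u.order := by
  intro P
  induction hdeg : P.natDegree using Nat.strong_induction_on generalizing P with
  | _ n ih =>
  intro hP
  by_cases h0 : P.coeff 0 = 0
  · -- `P = X * divX P`
    have hdiv : P = Polynomial.X * P.divX := by
      conv_lhs => rw [← Polynomial.X_mul_divX_add P, h0, map_zero, add_zero]
    have hdX0 : P.divX ≠ 0 := by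
      intro h; rw [h, mul_zero] at hdiv; exact hP hdiv
    have hlt : P.divX.natDegree < n := by
      rw [Polynomial.natDegree_divX_eq_natDegree_tsub_one, ← hdeg]
      have : 0 < P.natDegree := by
        by_contra! hle
        have := Polynomial.eq_C_of_natDegree_eq_zero (Nat.le_zero.mp hle)
        rw [h0, map_zero] at this
        exact hP this
      omega
    obtain ⟨hne, m, hm⟩ := ih _ hlt P.divX rfl hdX0
    refine ⟨?_, m + 1, ?_⟩
    · rw [hdiv, map_mul, Polynomial.aeval_X]; exact mul_ne_zero hu0 hne
    · rw [hdiv, map_mul, Polynomial.aeval_X, HahnSeries.order_mul hu0 hne, hm, add_comm, succ_nsmul]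
  · -- constant term non-zero: order `0`
    have hdecomp : Polynomial.aeval u P = HahnSeries.C (P.coeff 0) + u * Polynomial.aeval u P.divX := by
      conv_lhs => rw [← Polynomial.X_mul_divX_add P]
      rw [map_add, map_mul, Polynomial.aeval_X, Polynomial.aeval_C, ← HahnSeries.C_eq_algebraMap, add_comm]
    have hpos : 0 < (u * Polynomial.aeval u P.divX).orderTop :=
      orderTop_mul_pos hu (orderTop_aeval_nonneg hu.le _)
    have hot : (Polynomial.aeval u P).orderTop = 0 := by
      rw [hdecomp]; exact orderTop_C_add_eq_zero h0 hpos
    have hne : Polynomial.aeval u P ≠ 0 := by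
      intro h; rw [h, HahnSeries.orderTop_zero] at hot; exact WithTop.top_ne_coe hot
    refine ⟨hne, 0, ?_⟩
    rw [zero_nsmul]
    have := HahnSeries.order_eq_orderTop_of_ne_zero hne
    rw [hot, ← WithTop.coe_zero] at this
    exact WithTop.coe_injective this

/-- A non-zero series of positive order is transcendental over the coefficient field. [folklore] -/
theorem transcendental_of_orderTop_pos {u : HahnSeries Γ k} (hu0 : u ≠ 0) (hu : 0 < u.orderTop) :
    Transcendental k u :=
  transcendental_iff.mpr fun P hP0 => by
    by_contra hP
    exact (order_aeval_eq_nsmul hu0 hu P hP).1 hP0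

/-- **Values of `k(u)`.** For `u ≠ 0` of positive order, every non-zero element of the field `k(u)` has
order an INTEGER multiple of `order u`. [folklore] -/
theorem order_eq_zsmul_of_mem_adjoin_simple {u : HahnSeries Γ k} (hu0 : u ≠ 0) (hu : 0 < u.orderTop)
    {z : HahnSeries Γ k} (hz : z ∈ IntermediateField.adjoin k ({u} : Set (HahnSeries Γ k))) (hz0 : z ≠ 0) :
    ∃ m : ℤ, z.order = m • u.order := by
  obtain ⟨a, ha, b, hb, hab⟩ :=
    (IntermediateField.mem_adjoin_iff_div (F := k) (S := {u}) (x := z)).mp hz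
  rw [Algebra.adjoin_singleton_eq_range_aeval] at ha hb
  obtain ⟨P, rfl⟩ := (AlgHom.mem_range _).mp ha
  obtain ⟨Q, rfl⟩ := (AlgHom.mem_range _).mp hb
  have hP : P ≠ 0 := by rintro rfl; exact hz0 (by rw [hab]; simp)
  have hQ : Q ≠ 0 := by rintro rfl; exact hz0 (by rw [hab]; simp)
  obtain ⟨hPne, mP, hmP⟩ := order_aeval_eq_nsmul hu0 hu P hP
  obtain ⟨hQne, mQ, hmQ⟩ := order_aeval_eq_nsmul hu0 hu Q hQ
  refine ⟨(mP : ℤ) - mQ, ?_⟩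
  have hdiv : z * Polynomial.aeval u Q = Polynomial.aeval u P := by
    rw [hab]; exact div_mul_cancel₀ _ hQne
  have hord := congrArg HahnSeries.order hdiv
  rw [HahnSeries.order_mul hz0 hQne, hmP, hmQ] at hord
  rw [sub_zsmul, natCast_zsmul, natCast_zsmul, ← hord]
  abel

/-! ## Frobenius maps `k[S]` into `k[S ^ p]` -/

/-- In characteristic `p`, the `p`-th power of an element of `k[S]` lies in `k[{s ^ p | s ∈ S}]`. [folklore] -/
theorem pow_mem_adjoin_image_pow (p : ℕ) [Fact p.Prime] [CharP (HahnSeries Γ k) p]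
    (S : Set (HahnSeries Γ k)) {z : HahnSeries Γ k} (hz : z ∈ Algebra.adjoin k S) :
    z ^ p ∈ Algebra.adjoin k ((fun s => s ^ p) '' S) := by
  induction hz using Algebra.adjoin_induction with
  | mem x hx => exact Algebra.subset_adjoin ⟨x, hx, rfl⟩
  | algebraMap c => rw [← map_pow]; exact Subalgebra.algebraMap_mem _ _
  | add x y _ _ hx hy => rw [add_pow_char]; exact Subalgebra.add_mem _ hx hy
  | mul x y _ _ hx hy => rw [mul_pow]; exact Subalgebra.mul_mem _ hx hy

end General

/-! ## Generic power series: a counting argument -/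

section Counting

variable (p : ℕ) [hp : Fact p.Prime]

/-- Coefficient of `natSer c` at `(n+1) • 1`. -/
theorem coeff_natSer (c : ℕ → ZMod p) (n : ℕ) : (natSer p c).coeff ((n + 1) • one' p) = c n := by
  classical
  have hmem : (n + 1) • one' p ∈ natSupp p := ⟨n, rfl⟩
  show (if h : (n + 1) • one' p ∈ natSupp p then c (Classical.choose h) else 0) = c n
  rw [dif_pos hmem]
  have hspec := Classical.choose_spec hmem
  -- injectivity of `n ↦ (n+1) • 1`
  have hinj : ∀ a b : ℕ, (a + 1) • one' p = (b + 1) • one' p → a = b := by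
    intro a b hab
    have h := congrArg (fun g : PInv p => (g : ℚ)) hab
    simp only [AddSubgroupClass.coe_nsmul, coe_one', nsmul_eq_mul, mul_one] at h
    have h' : a + 1 = b + 1 := by exact_mod_cast h
    omega
  rw [hinj _ _ hspec]

/-- Coefficients of `natSer c` off `natSupp` vanish. -/
theorem coeff_natSer_of_not_mem (c : ℕ → ZMod p) {g : PInv p} (hg : g ∉ natSupp p) :
    (natSer p c).coeff g = 0 := by
  classical
  show (if h : g ∈ natSupp p then c (Classical.choose h) else 0) = 0
  rw [dif_neg hg]

/-- `natSer` is injective. -/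
theorem natSer_injective : Function.Injective (natSer p) := by
  intro c c' h
  funext n
  rw [← coeff_natSer p c n, ← coeff_natSer p c' n, h]

omit hp in
/-- Elements of `natSupp` are `≥ 1`. -/
theorem one'_le_of_mem_natSupp {g : PInv p} (hg : g ∈ natSupp p) : one' p ≤ g := by
  obtain ⟨n, rfl⟩ := hg
  show ((one' p : PInv p) : ℚ) ≤ (((n + 1) • one' p : PInv p) : ℚ)
  simp only [AddSubgroupClass.coe_nsmul, coe_one', nsmul_eq_mul, mul_one]
  exact_mod_cast Nat.le_add_left 1 n

/-- The generic series have order `≥ 1 > 0`. -/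
theorem orderTop_natSer_pos (c : ℕ → ZMod p) : 0 < (natSer p c).orderTop := by
  refine lt_of_lt_of_le (WithTop.coe_pos.mpr (one'_pos p)) ?_
  rw [HahnSeries.le_orderTop_iff_forall]
  intro g hg
  apply coeff_natSer_of_not_mem
  intro hmem
  exact not_le.mpr (WithTop.coe_lt_coe.mp hg) (one'_le_of_mem_natSupp p hmem)

/-- **Counting argument.** Over a COUNTABLE `𝔽_p`-subalgebra `B` of `Ω` some generic power series
`natSer c` is transcendental: the elements of `Ω` algebraic over `B` form a countable set (countably many
polynomials, finitely many roots each), while `c ↦ natSer c` injects the uncountable set `ℕ → 𝔽_p`. [folklore] -/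
theorem exists_natSer_transcendental (B : Subalgebra (ZMod p) (Ω p)) (hB : (B : Set (Ω p)).Countable) :
    ∃ c : ℕ → ZMod p, Transcendental B (natSer p c) := by
  classical
  haveI : Countable B := hB.to_subtype
  -- algebraic elements over `B` form a countable set
  have hcount : {z : Ω p | IsAlgebraic B z}.Countable := by
    have hpoly : Countable (Polynomial B) := by
      rw [← Cardinal.mk_le_aleph0_iff]
      exact (Polynomial.cardinalMk_le_max (R := B)).trans (max_le (Cardinal.mk_le_aleph0_iff.mpr inferInstance) le_rfl)
    have hsub : {z : Ω p | IsAlgebraic B z} ⊆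
        ⋃ f : Polynomial B, (((f.map (algebraMap B (Ω p))).roots.toFinset : Finset (Ω p)) : Set (Ω p)) := by
      intro z hz
      obtain ⟨f, hf0, hf⟩ := hz
      refine Set.mem_iUnion.mpr ⟨f, ?_⟩
      rw [Finset.mem_coe, Multiset.mem_toFinset, Polynomial.mem_roots_map_of_injective
        (show Function.Injective (algebraMap B (Ω p)) from fun a b h => Subtype.ext h) hf0]
      rwa [Polynomial.aeval_def] at hf
    exact (Set.countable_iUnion fun f => Finset.countable_toSet _).mono hsub
  by_contra! hall
  -- then every `natSer c` is algebraic: an injection of an uncountable type into a countable set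
  have hrange : Set.range (natSer p) ⊆ {z : Ω p | IsAlgebraic B z} := by
    rintro _ ⟨c, rfl⟩
    have := hall c
    rwa [Transcendental, not_not] at this
  have hcr : (Set.range (natSer p)).Countable := hcount.mono hrange
  have hcdom : Countable (ℕ → ZMod p) := by
    have e := Equiv.ofInjective _ (natSer_injective p)
    haveI := hcr.to_subtype
    exact Countable.of_equiv _ e.symm
  -- but `ℕ → 𝔽_p` is uncountable
  have hunc : ¬ Countable (ℕ → ZMod p) := by
    rw [← Cardinal.mk_le_aleph0_iff, not_le]
    have h2 : (2 : Cardinal) ≤ Cardinal.mk (ZMod p) := by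
      have : Cardinal.mk (ZMod p) = p := by simp
      rw [this]; exact_mod_cast hp.out.two_le
    calc Cardinal.aleph0 < 2 ^ Cardinal.aleph0 := Cardinal.cantor _
      _ ≤ Cardinal.mk (ZMod p) ^ Cardinal.aleph0 := Cardinal.power_le_power_right h2
      _ = Cardinal.mk (ℕ → ZMod p) := by
          rw [Cardinal.mk_arrow, Cardinal.lift_id, Cardinal.lift_id, Cardinal.mk_nat]
  exact hunc hcdom

/-- Intermediate fields generated over `𝔽_p` by finitely many elements are countable (as sets). [folklore] -/
theorem countable_adjoin_of_finite (S : Set (Ω p)) (hS : S.Finite) :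
    ((IntermediateField.adjoin (ZMod p) S : IntermediateField (ZMod p) (Ω p)) : Set (Ω p)).Countable := by
  have hgen : ((IntermediateField.adjoin (ZMod p) S : IntermediateField (ZMod p) (Ω p)) : Set (Ω p)) =
      (Subfield.closure (Set.range (algebraMap (ZMod p) (Ω p)) ∪ S) : Set (Ω p)) := rfl
  rw [hgen]
  have hs : (Set.range (algebraMap (ZMod p) (Ω p)) ∪ S).Countable :=
    (Set.countable_range _).union hS.countable
  rw [← Set.countable_coe_iff, ← Cardinal.mk_le_aleph0_iff]
  refine (Subfield.cardinalMk_closure_le_max _).trans (max_le ?_ le_rfl)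
  exact Cardinal.mk_le_aleph0_iff.mpr hs.to_subtype

end Counting

end Summit.ResolutionOfSingularities.ResolutionOfSingularities.Theorems.SwitchingDichotomy.Core4Hahn
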